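import Literature.RepresentationTheory.MoeglinVignerasWaldspurger1987.RankOneThetaLiftLinesEquivalent
import Literature.NumberTheory.Automorphic.Liu2021.LemD1AsPrintedIndexedNonVacuityAtPlace
import Literature.NumberTheory.Automorphic.UnitaryGroupNonsplitPlace
import Literature.NumberTheory.Automorphic.Liu2021.Def411WeilCarriersLocalDataAtV
import HarnessLib

/-!
# At a SPLIT place all skew-hermitian lines are in ONE class: the `ε`-clause of [Liu2021, Lem. D.1 (3)] is empty there
# — THEOREMS ONLY

Topic `RepresentationTheory/MoeglinVignerasWaldspurger1987`; companion of `RankOneThetaLiftLinesDisjoint.lean` (row IV-4c1: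
lines of DIFFERENT classes, non-split places), `RankOneThetaLiftLinesEquivalent.lean` (row IV-4(b): lines of the SAME class
give isomorphic lifts, any place) and `RankOneThetaLiftTwistRigiditySplit.lean` (row IV-4c4, split places), in the same
currency (two trace-zero `δ₁, δ₂`; the hypothesis `δ₂ ⊗ 1 = x xᶜ (δ₁ ⊗ 1)`).  KERNEL ONLY: no definition, no named fact,
no `sorry`.

AS PRINTED. [Liu2021, App. D §D.1 Step 1] (l. 5217): «`ε` ranges over `E^{−×}/Nm_{E/F} E^×`», and the proof of Lemma D.1,
split case (l. 5249, held arXiv chunk p0056 L32): «We consider first the case where `E = F × F`. We identify `U(V)` with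
`GL_n(F)` and `E^−` with `F` through the first factor» — at a split place `Nm : E_vˣ = F_vˣ × F_vˣ → F_vˣ` is onto, so
`E_v^{−×}/Nm E_vˣ` is ONE point and the `ε`-clause of (3) is automatic.  At the tree's objects:

* `exists_eq_algebraMap_mul_of_apply_eq_neg` — two trace-zero elements of a quadratic `E/F` are `F`-proportional:
  `δ₂ = b δ₁` with `b ∈ F` (`E = F ⊕ F δ₁`, and `c δ₂ = -δ₂` kills the `F`-component; characteristic `0`);
* **`exists_norm_mul_of_not_isField`** — at a place `v` with `E_v = E ⊗_F F_v` NOT a field (split), `δ₂ ⊗ 1 = x xᶜ (δ₁ ⊗ 1)`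
  for some unit `x ∈ E_vˣ` (the ratio `b ∈ Fˣ ⊂ F_vˣ` is a local norm, tree
  `LemD1IndexedNonVacuityAtPlace.exists_mul_conjLocal_eq_algebraMap_of_split`; a place with all `w ∣ v` fixed by `c` is
  non-split, tree `UnitaryGroup.LocalRing.isField_of_smul_eq`) — the hypothesis `hx` of `RankOneThetaLiftLinesEquivalent`;
* **`sameClass_eps_of_not_isField`** — hence `LemD1.SameClass` of the Step-1 representatives `LemD1OfPlace.eps E v hδ₁`,
  `LemD1OfPlace.eps E v hδ₂` in the standing data at `v` (READING L3′): the `ε`-third of `LemD1_3AsPrintedI` at a split place;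
* **`sameClass_epsLine_of_not_isField`** — the same in the currency of the indexed family of record
  `Def411WeilCarriers.localIndexedFamilyAtV` (ONE `δ` in the standing data, members `eps t = epsLine E hδ (a_t) v = (a_t δ) ⊗ 1`,
  `a_t ∈ Fˣ`): at a split place `epsLine E hδ a₁ v` and `epsLine E hδ a₂ v` are in the same class (`a₂/a₁ ∈ F_vˣ` is a norm).

Cell hodgecm-mathlib, rows IV-4(b)/IV-4c1/IV-4c4 consumer glue (a4-liuD3 `by_cases hE`); seat B-typ01.  HC_CM is NOT
proved here.

## References
* [Liu2021] Y. Liu, Camb. J. Math. 9 (2021) = arXiv:2102.11518 — App. D §D.1 Step 1 (l. 5217); proof of Lem. D.1, split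
  case (l. 5249; chunk p0056 L32).
* [CasselsFrohlichANT1967] J. W. S. Cassels, A. Fröhlich (eds.), *Algebraic Number Theory* (1967) — Ch. II §10
  (`L ⊗_K K_v = ∏_{w ∣ v} L_w`).
-/

noncomputable section

namespace Literature.RepresentationTheory.MoeglinVignerasWaldspurger1987

open NumberField IsDedekindDomain
open scoped Matrix
open Literature.NumberTheory.Automorphic
open Literature.NumberTheory.Automorphic.UnitaryGroup
open Literature.NumberTheory.Automorphic.Liu2021 (LemD1.SameClass LemD1OfPlace.eps LemD1OfPlace.eps_mem_skew
  LemD1OfPlace.standingData)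

variable {F : Type} [Field F] [NumberField F] (E : Type) [Field E] [NumberField E] [Algebra F E]
  [Algebra.IsQuadraticExtension F E] (v : HeightOneSpectrum (𝓞 F)) (c : E ≃ₐ[F] E)
  {δ₁ δ₂ : E} (hcδ₁ : c δ₁ = -δ₁) (hδ₁ : δ₁ ≠ 0) (hcδ₂ : c δ₂ = -δ₂)

include hcδ₁ hδ₁ hcδ₂ in
/-- **two trace-zero elements of a quadratic extension are `F`-proportional**: `δ₂ = b · δ₁` with `b ∈ F` (write
`δ₂ = a + b δ₁` in `E = F ⊕ F δ₁`; applying `c` gives `-δ₂ = a - b δ₁`, so `2a = 0`). [cite: Liu2021, App. D §D.1 Step 1 (l. 5217)] -/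
theorem exists_eq_algebraMap_mul_of_apply_eq_neg : ∃ b : F, δ₂ = algebraMap F E b * δ₁ := by
  obtain ⟨a, b, h⟩ := exists_eq_add_mul_of_isQuadraticExtension E (not_mem_range_algebraMap_of_apply_eq_neg E c hcδ₁ hδ₁) δ₂
  have hc2 : c δ₂ = algebraMap F E a - algebraMap F E b * δ₁ := by
    rw [h, map_add, map_mul, AlgEquiv.commutes, AlgEquiv.commutes, hcδ₁, mul_neg, sub_eq_add_neg]
  have ha : (2 : E) * algebraMap F E a = 0 := by
    have e := hc2.symm.trans hcδ₂
    rw [h] at e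
    linear_combination e
  have ha0 : algebraMap F E a = 0 := (mul_eq_zero.1 ha).resolve_left two_ne_zero
  exact ⟨b, by rw [h, ha0, zero_add]⟩

include hcδ₁ hδ₁ hcδ₂ in
/-- **at a SPLIT place the two lines are in the same class**: if `E_v = E ⊗_F F_v` is not a field then
`δ₂ ⊗ 1 = x xᶜ (δ₁ ⊗ 1)` for some `x ∈ E_vˣ` — the ratio `δ₂/δ₁ = b ∈ Fˣ` is a local norm at a split place (tree
`exists_mul_conjLocal_eq_algebraMap_of_split`: every `a ∈ F_vˣ` is a norm from `E_w × E_w̄`).  This is the hypothesis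
`hx` of `RankOneThetaLiftLinesEquivalent.lean` and the negation of the class hypothesis of `rankOne_theta_lines_disjoint`.
[cite: Liu2021, App. D proof of Lemma D.1, split case (l. 5249); CasselsFrohlichANT1967, Ch. II §10] -/
theorem exists_norm_mul_of_not_isField (hδ₂ : δ₂ ≠ 0) (hv : ¬ IsField (LocalRing E v)) :
    ∃ x : (LocalRing E v)ˣ, algebraMap E (LocalRing E v) δ₂ =
      (x : LocalRing E v) * conjLocal E c v x * algebraMap E (LocalRing E v) δ₁ := by
  -- a place `w ∣ v` moved by `c` (otherwise `E_v` is a field)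
  have hc1 : c ≠ 1 := by
    rintro rfl
    rw [AlgEquiv.one_apply] at hcδ₁
    exact hδ₁ (add_self_eq_zero.mp (eq_neg_iff_add_eq_zero.mp hcδ₁))
  obtain ⟨w⟩ := PlacesOver.nonempty E v
  have hw : c • w.1 ≠ w.1 := fun hw => hv (LocalRing.isField_of_smul_eq c hc1 w hw)
  -- the ratio `b ∈ Fˣ`
  obtain ⟨b, hb⟩ := exists_eq_algebraMap_mul_of_apply_eq_neg E c hcδ₁ hδ₁ hcδ₂
  have hb0 : b ≠ 0 := by
    rintro rfl
    rw [map_zero, zero_mul] at hb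
    exact hδ₂ hb
  have hbv : ((b : v.adicCompletion F)) ≠ 0 := by
    rw [ne_eq, ← map_zero (algebraMap F (v.adicCompletion F))]
    exact fun h => hb0 ((algebraMap F (v.adicCompletion F)).injective h)
  -- `b` is a local norm at the split place
  obtain ⟨x, hx⟩ := Liu2021.LemD1IndexedNonVacuityAtPlace.exists_mul_conjLocal_eq_algebraMap_of_split E v c w hw (Units.mk0 _ hbv)
  refine ⟨x, ?_⟩
  rw [hx, Units.val_mk0, algebraMap_localRing_eq, toLocalRing_coe, ← map_mul, ← hb]

variable (N : ℕ) (J : Matrix (Fin N) (Fin N) E) (hN : 2 ≤ N) (hJh : (J.map c)ᵀ = J) (hJdet : J.det ≠ 0)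

include hcδ₂ in
/-- **the `ε`-clause of [Liu2021, Lem. D.1 (3)] is automatic at a SPLIT place**: the Step-1 representatives
`ε₁ = δ₁ ⊗ 1`, `ε₂ = δ₂ ⊗ 1` of the standing data at `v` are in the same class of `E_v^{−×}/Nm E_vˣ` (`LemD1.SameClass`,
READING L3′) whenever `E_v` is not a field. [cite: Liu2021, App. D §D.1 Step 1 (l. 5217) and proof of Lemma D.1, split case (l. 5249)] -/
theorem sameClass_eps_of_not_isField (hδ₂ : δ₂ ≠ 0) (hv : ¬ IsField (LocalRing E v)) :
    LemD1.SameClass (S := LemD1OfPlace.standingData E v c N J hcδ₁ hδ₁ hN hJh hJdet)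
        ⟨LemD1OfPlace.eps E v hδ₁, LemD1OfPlace.eps_mem_skew E v c N J hcδ₁ hδ₁ hN hJh hJdet⟩
        ⟨LemD1OfPlace.eps E v hδ₂, eps_mem_skew_of E v c N J hcδ₁ hδ₁ hN hJh hJdet hδ₂ hcδ₂⟩ :=
  (sameClass_eps_iff_exists E v c N hcδ₁ hδ₁ hcδ₂ hδ₂ hN hJh hJdet).mpr
    (exists_norm_mul_of_not_isField E v c hcδ₁ hδ₁ hcδ₂ hδ₂ hv)

/-! ### In the currency of the indexed family of record (`Def411WeilCarriers.localIndexedFamilyAtV`: one `δ`, lines `a_t · δ`) -/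

section EpsLine

open Literature.NumberTheory.Automorphic.Liu2021.Def411WeilCarriers (epsLine coe_epsLine epsLine_mem_skew)

variable {δ : E} (hcδ : c δ = -δ) (hδ : δ ≠ 0)

include hcδ in
/-- **at a SPLIT place the Step-1 representatives `(a₁ δ) ⊗ 1`, `(a₂ δ) ⊗ 1` of two members of the family of record are in
the same class** (`LemD1.SameClass` in the ONE standing data `LemD1OfPlace.standingData … hcδ hδ …` of
`localIndexedFamilyAtV`, members `eps t = epsLine E hδ (a_t) v`): `(a₂ δ) ⊗ 1 = x xᶜ · ((a₁ δ) ⊗ 1)` with `x xᶜ = ι_v(a₂ a₁⁻¹)`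
(tree `exists_mul_conjLocal_eq_algebraMap_of_split`).  Closes the `ε`-third of `LemD1_3AsPrintedI (localIndexedFamilyAtV …)`
at split places by name. [cite: Liu2021, App. D §D.1 Step 1 (l. 5217) and proof of Lemma D.1, split case (l. 5249)] -/
theorem sameClass_epsLine_of_not_isField (a₁ a₂ : Fˣ) (hv : ¬ IsField (LocalRing E v)) :
    LemD1.SameClass (S := LemD1OfPlace.standingData E v c N J hcδ hδ hN hJh hJdet)
        ⟨epsLine E hδ a₁ v, epsLine_mem_skew E c N J hcδ hδ hN hJh hJdet a₁ v⟩
        ⟨epsLine E hδ a₂ v, epsLine_mem_skew E c N J hcδ hδ hN hJh hJdet a₂ v⟩ := by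
  -- a place `w ∣ v` moved by `c`
  have hc1 : c ≠ 1 := by
    rintro rfl
    rw [AlgEquiv.one_apply] at hcδ
    exact hδ (add_self_eq_zero.mp (eq_neg_iff_add_eq_zero.mp hcδ))
  obtain ⟨w⟩ := PlacesOver.nonempty E v
  have hw : c • w.1 ≠ w.1 := fun hw => hv (LocalRing.isField_of_smul_eq c hc1 w hw)
  -- `a₂ a₁⁻¹ ∈ F_vˣ` is a local norm
  have hbv : ((((a₂ * a₁⁻¹ : Fˣ) : F) : v.adicCompletion F)) ≠ 0 := by
    rw [ne_eq, ← map_zero (algebraMap F (v.adicCompletion F))]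
    exact fun h => (a₂ * a₁⁻¹).ne_zero ((algebraMap F (v.adicCompletion F)).injective h)
  obtain ⟨x, hx⟩ :=
    Liu2021.LemD1IndexedNonVacuityAtPlace.exists_mul_conjLocal_eq_algebraMap_of_split E v c w hw (Units.mk0 _ hbv)
  refine ⟨x, Units.ext ?_⟩
  change ((epsLine E hδ a₂ v : (LocalRing E v)ˣ) : LocalRing E v) =
    (x : LocalRing E v) * conjLocal E c v x * ((epsLine E hδ a₁ v : (LocalRing E v)ˣ) : LocalRing E v)
  rw [hx, Units.val_mk0, algebraMap_localRing_eq, toLocalRing_coe, coe_epsLine, coe_epsLine, ← map_mul]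
  congr 1
  have ha₁ : algebraMap F E (a₁ : F) ≠ 0 := (map_ne_zero (algebraMap F E)).2 a₁.ne_zero
  rw [Units.val_mul, Units.val_inv_eq_inv_val, map_mul, map_inv₀, mul_assoc, inv_mul_cancel_left₀ ha₁]

end EpsLine

end Literature.RepresentationTheory.MoeglinVignerasWaldspurger1987

end
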